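import Summits.BirchSwinnertonDyer.BirchSwinnertonDyer.Theorems.PrintCf2SplitBadTwoRestrictedSurjOfConjFiniteness
import Summits.BirchSwinnertonDyer.BirchSwinnertonDyer.Theorems.PrintCf2SplitBadTwoRestrictedSelmerCokernelOfLocSurjFinite
import Summits.BirchSwinnertonDyer.BirchSwinnertonDyer.Theorems.PrintCf2SplitBadTwoRestrictedSelmerRelaxedSummandExponent
import Summits.BirchSwinnertonDyer.BirchSwinnertonDyer.Theorems.PrintCf2SplitBadTwoRestrictedSelmerConjTransportFrame
import Summits.BirchSwinnertonDyer.BirchSwinnertonDyer.Theorems.PrintCf2SplitBadTwoCMPrimaryLocalFixedPoints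
import HarnessLib

/-!
# Crux `PrintCf2.SplitBadTwoRankOneOfFacts` (stmt-BirchSwinnertonDyer-20368), road α v10.3 — the two displayed finiteness inputs hfinR′, hfix of the
# Poitou–Tate assemblies (p673077 (R-TOP), p673366 (R-SURJ″)) ARE THEOREMS on every S3c frame; hence
# **cut 9's (R-SURJ″) ⟸ the cited fact `poitouTate_selmerStructure_duality` ALONE**

Cell `bsd-print-cf2`, width seat `bsd-line-cf2-p1-w5` g3 (prover-bsd-line-cf2-p1-w5-g3-0); lane «(R-SURJ)». `--supports stmt-BirchSwinnertonDyer-20368`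
(helper, Theses-free). HONEST FRAMING: nothing here closes the crux or a registered stub; BSD is not proved by any of this; no summit statement is proved
by this seat. No definition, no named fact, no `sorry`. CONDITIONAL only on the cited Literature fact `poitouTate_selmerStructure_duality K` (Howard 2004
Thm. 2.1.11 / Milne ADT I.4.10, the tree's named fact) — and, for the (R-TOP) corollary, on `poitouTate_sha_tateDual K` and `fieldCdLE_two_of_numberField`.

WHAT. -w4 g9's (R-TOP) assembly `natCard_endCoinvariants_eq_one_of_frame_of_conjFiniteness` (p673077) and this lane's (R-SURJ″) assembly
`rSurj''_of_conjFiniteness` (p673366) display two finiteness inputs about the CONJUGATE summand `W*′ = E[𝔮_{1−r}^∞]` / the place `v`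
(«both FREE for any width seat», STATUS 22:15:49Z). Both are theorems:
* **`finite_map_selmerGroup_acStructure_of_apply_eq_proj`** (generic elliptic `V` over a number field, `p`, `π`, `r′`, `𝔮`, ANY finite `R`) — hfinR′:
  the `H¹(j′)`-image of Castella's relaxed group `H¹_{𝓛^{ac,R}_𝔮}(K, E[p^∞])` is finite as soon as `𝔖_𝔮(K, W*′)` is: `H¹(j′) = H¹(ι′) ∘ H¹(e′)`
  (cocycle level) and `H¹(e′)` lands in the relaxed group of `W*′` (-w3 g9 `map_mem_selmerGroup_acStructure`), which is finite (-w3 g9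
  `finite_selmerGroup_acStructure_summand`, p670630).
* **`two_pow_two_nsmul_eq_zero_of_restrictField_fixed_of_frame`** — hfix with `m = 2` on every S3c frame: a point of `E[2^∞]` fixed by `Γ_{K_v}`
  (through `restrictField`, i.e. by the decomposition group `D_v = range(Γ_{K_v} → Γ_K)`) splits as `e Q + (Q − e Q)` along the CM summands
  (-w7 g2 `exists_eigenProjector_two`), each piece is `D_v`-fixed and killed by `4` (-w2 g8 `exists_mem_decomp_four_nsmul_eq_zero_of_smul_eq`,
  p656168 lineage: `H⁰(K_v, E[𝔮_ρ^∞]) ∈ {ℤ/2, ℤ/4}` for either local type).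
* **`finite_map_selmerGroup_acStructure_of_frame_of_finite`** — hfinR′ on every frame from the frame's OWN bottom finiteness `𝔖_{v̄}(K, W*)` via
  -w2 g10's conjugation transport `ConjTransport.finite_restrictedSelmerBase_conj_of_finite` (p672135 lineage).
* **`rSurj''_of_poitouTate (hPTs : ∀ K, poitouTate_selmerStructure_duality K) : <cut 7/8/9 hSurj VERBATIM>`** (`e_s ≡ −1`) — file 4c's
  `rSurj''_of_locSurj_of_finite` + `locSurj_of_frame_of_conjFiniteness` (p673366) + the three theorems above: **RESIDUAL (R-SURJ″) DISCHARGED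
  modulo the cited fact.**
* **`natCard_endCoinvariants_eq_one_of_frame_of_poitouTate`** — -w4 g9's (R-TOP) p673077 with hfinB′, hfinR′, hfix ALL DISCHARGED from the
  frame's dual datum: `#𝔖_Γ = 1` on every S3c frame ⟸ the three cited facts + `[W.IsGloballyMinimal]`; **`rTop'_of_poitouTate (hPT hPTs hcd)`** —
  cut 9's `hTop` in class form (`eΓ ≡ 0`) with the one extra binder `[W.IsGloballyMinimal]`.
SO CUT 10 CAN READ: S3c ⟸ `hPT ∧ hPTs ∧ hcd` (cited facts) ∧ (R-BV) — `hTop := rTop'_of_poitouTate hPT hPTs hcd` (after adding the binder),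
`hSurj := rSurj''_of_poitouTate hPTs`.
presearch: not applicable (assembly of tree theorems). beyond-print theorem: no.

References: [JetchevSkinnerWan2017] Prop. 3.3.2, Lemma 3.3.3; [Howard2004HeegnerKolyvagin] Thm. 2.1.11; [Agboola2007] §3 Prop. 3.2, §5–6;
[GreenbergLNM1716] §3 Lemmas 3.1–3.3, §4; [Rubin1999] §3 Lemma 3.6.
-/

noncomputable section

open scoped Classical

set_option linter.dupNamespace false
set_option autoImplicit false

open CategoryTheory NumberField IsDedekindDomain Field WeierstrassCurve
open Literature.NumberTheory.EllipticCurves Literature.NumberTheory.EllipticCurves.GreenbergSelmer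
open Literature.NumberTheory.EllipticCurves.Agboola2007
open Literature.NumberTheory.EllipticCurves.IwasawaAlgebra
open Literature.NumberTheory.EllipticCurves.IwasawaDual
open Literature.NumberTheory.GaloisRepresentations
open Literature.NumberTheory.GaloisCohomology
open scoped ContRepresentation
open Summit.BirchSwinnertonDyer.Rank1Residual.X11b
open Summit.BirchSwinnertonDyer.Rank1Residual.X11b.LocBridge
open Summit.BirchSwinnertonDyer.Rank1Residual.X11b.AcSelmer
open Summit.BirchSwinnertonDyer.BirchSwinnertonDyer.Theorems.PrintCf2.AdditiveAtSeven
open Summit.BirchSwinnertonDyer.BirchSwinnertonDyer.Theorems.PrintCf2.LevelEigen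
open Summit.BirchSwinnertonDyer.BirchSwinnertonDyer.Theorems.PrintCf2.RelaxedExponent
open Summit.BirchSwinnertonDyer.BirchSwinnertonDyer.Theorems.GoldfeldGoodTwists
open Summit.BirchSwinnertonDyer.BirchSwinnertonDyer.Theorems.PrintCf2.CMPrimes

universe u

namespace Summit.BirchSwinnertonDyer.BirchSwinnertonDyer.Theorems.PrintCf2.RestrictedSelmerPair

/-! ## §1. hfinR′ — generic: the `H¹(j′)`-image of Castella's relaxed group is finite when `𝔖_𝔮(K, W*′)` is -/

section FinR

variable {K : Type u} [Field K] [NumberField K] (V : WeierstrassCurve K) [V.IsElliptic] (p : ℕ) [Fact p.Prime]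
  (π : V.endRing) (r' : ℤ_[p]) (𝔮 : HeightOneSpectrum (𝓞 K))

/-- **hfinR′ from hfinB′.** Given ONE equivariant projector `e₀ : E[p^∞] → W*′ = E[𝔮_{r′}^∞]` (`e₀ ∘ ι′ = id`; makes the relaxed group of `W*′`
finite) and ANY equivariant additive `e′ : E[p^∞] → W*′` with an intertwining endomorphism `j′` of `E[p^∞]`, `j′ Q = ι′ (e′ Q)`, any finite `R`, and
`𝔖_𝔮(K, W*′)` finite: the `H¹(j′)`-image of `H¹_{𝓛^{ac,R}_𝔮}(K, E[p^∞])` is finite (`H¹(j′) = H¹(ι′) ∘ H¹(e′)`, `H¹(e′)` maps into the finite relaxed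
group of `W*′`). [cite: JetchevSkinnerWan2017, Prop. 3.3.2 (arXiv:1512.06894 p. 11)]
[cite: GreenbergLNM1716, §3 Lemma 3.3 (p. 87)] -/
theorem finite_map_selmerGroup_acStructure_of_apply_eq_proj
    (e₀ : V.geomPrimaryTorsion p →+ ↥(V.endEigenPrimaryTorsion p π r'))
    (he₀₁ : ∀ x : ↥(V.endEigenPrimaryTorsion p π r'), e₀ x = x)
    (he₀ : ∀ (σ : absoluteGaloisGroup K) (x : V.geomPrimaryTorsion p), e₀ (σ • x) = σ • e₀ x)
    (e' : V.geomPrimaryTorsion p →+ ↥(V.endEigenPrimaryTorsion p π r'))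
    (he' : ∀ (σ : absoluteGaloisGroup K) (x : V.geomPrimaryTorsion p), e' (σ • x) = σ • e' x)
    (j' : (primaryGaloisModule V p).toContRepresentation →ⁱL (primaryGaloisModule V p).toContRepresentation)
    (hj' : ∀ Q : V.geomPrimaryTorsion p, j' Q = (e' Q : V.geomPrimaryTorsion p))
    {R : Set (HeightOneSpectrum (𝓞 K))} (hR : R.Finite)
    (hfin : Finite (restrictedSelmerBase ↥(V.endEigenPrimaryTorsion p π r') p 𝔮)) :
    Finite (((acStructure (primaryGaloisModule V p) p 𝔮 R).selmerGroup).map (galoisCohomology.map j' 1)) := by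
  haveI hF := finite_selmerGroup_acStructure_summand V p π r' 𝔮 e₀ he₀₁ he₀ hR hfin
  obtain ⟨ιI, hι⟩ := exists_summandIncl V p π r'
  obtain ⟨eI, heI⟩ := exists_summandProj V p π r' e' he'
  -- `H¹(j′) = H¹(ι′) ∘ H¹(e′)` on classes
  have hfac : ∀ x : galoisCohomology (primaryGaloisModule V p) 1,
      galoisCohomology.map j' 1 x = galoisCohomology.map ιI 1 (galoisCohomology.map eI 1 x) := by
    intro x
    obtain ⟨φ, rfl⟩ := oneCocycleClass_surjective _ x
    rw [galoisCohomology.map_one_oneCocycleClass, galoisCohomology.map_one_oneCocycleClass, galoisCohomology.map_one_oneCocycleClass]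
    exact congrArg (oneCocycleClass _) (Subtype.ext (ContinuousMap.ext fun σ ↦ by
      change j' (φ.1 σ) = ιI (eI (φ.1 σ))
      rw [hj', heI, hι]))
  -- the image lies in the image of the finite relaxed group of `W*′` under `H¹(ι′)`
  set SR := (acStructure (ofSMul ↥(V.endEigenPrimaryTorsion p π r') (isOpen_setOf_smul_eq_summand V p π r')) p 𝔮 R).selmerGroup
    with hSR
  have hle : ((acStructure (primaryGaloisModule V p) p 𝔮 R).selmerGroup).map (galoisCohomology.map j' 1) ≤
      SR.map (galoisCohomology.map ιI 1) := by
    rintro _ ⟨x, hx, rfl⟩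
    exact ⟨galoisCohomology.map eI 1 x, map_mem_selmerGroup_acStructure eI p 𝔮 R hx, (hfac x).symm⟩
  haveI : Finite (SR.map (galoisCohomology.map ιI 1)) := by
    haveI : Finite SR := hF
    exact Finite.of_surjective (fun x : SR ↦ (⟨galoisCohomology.map ιI 1 x, ⟨x, x.2, rfl⟩⟩ : SR.map (galoisCohomology.map ιI 1)))
      fun y ↦ by
        obtain ⟨x, hx, hxy⟩ := y.2
        exact ⟨⟨x, hx⟩, Subtype.ext hxy⟩
  exact Finite.of_injective _ (AddSubgroup.inclusion_injective hle)

end FinR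

/-! ## §2. Road α: hfix (`m = 2`) and hfinR′ on every S3c frame -/

section Frame

variable {K : Type} [Field K] [NumberField K]

/-- **hfix on every S3c frame, with `m = 2`**: a point of `E[2^∞]` fixed by `Γ_{K_v}` (acting through `restrictField`, i.e. through the decomposition
group `D_v = range(Γ_{K_v} → Γ_K)`) is killed by `4`: it splits along the CM summands `E[𝔮_r^∞] ⊕ E[𝔮_{1−r}^∞]` (equivariant projector `e`,
-w7 g2), each component is `D_v`-fixed, and on either summand some `δ ∈ D_v` fixes only `4`-torsion (-w2 g8). [cite: Rubin1999, §3 Lemma 3.6 (ii)]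
[cite: Agboola2007, §6] -/
theorem two_pow_two_nsmul_eq_zero_of_restrictField_fixed_of_frame {d : ℤ} (hd0 : d ≠ 0) (W : WeierstrassCurve ℚ) [W.IsElliptic]
    (C : VariableChange ℚ) (hC : C • W = cm7.quadraticTwist (d : ℚ)) (hK : IsImaginaryQuadratic K)
    {v vbar : HeightOneSpectrum (𝓞 K)} (hv : ((2 : ℕ) : 𝓞 K) ∈ v.asIdeal) (hvbar : ((2 : ℕ) : 𝓞 K) ∈ vbar.asIdeal) (hne : vbar ≠ v)
    (π : (W.baseChange K).endRing) (hrel : (π : AddMonoid.End (W.baseChange K).geomPoints) * π = π - 2) {r : ℤ_[2]} (hr : r * r = r - 2) :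
    ∃ m : ℕ, ∀ Q : (W.baseChange K).geomPrimaryTorsion 2,
      (∀ σ : absoluteGaloisGroup (v.adicCompletion K),
        GaloisRep.restrictField (v.adicCompletion K) (primaryGaloisModule (W.baseChange K) 2) σ Q = Q) → 2 ^ m • Q = 0 := by
  haveI : Fact (Nat.Prime 2) := ⟨Nat.prime_two⟩
  have hj : W.j = -3375 := j_eq_of_smul_eq_cm7Twist hd0 W C hC
  obtain ⟨θ, hθ⟩ := exists_sq_eq_neg_seven_of_cmEndo_mem_endRing W K hj π hrel
  have hr' : (1 - r) * (1 - r) = (1 - r) - 2 := by linear_combination hr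
  obtain ⟨e, he₁, -, hesub, he⟩ := exists_eigenProjector_two W hj K hθ π hrel hr
  obtain ⟨δ₁, hδ₁, h4₁⟩ := exists_mem_decomp_four_nsmul_eq_zero_of_smul_eq W K hj hK.1 hθ π hrel hr hv hvbar hne
  obtain ⟨δ₂, hδ₂, h4₂⟩ := exists_mem_decomp_four_nsmul_eq_zero_of_smul_eq W K hj hK.1 hθ π hrel hr' hv hvbar hne
  refine ⟨2, fun Q hQ ↦ ?_⟩
  -- `Q` is fixed by every element of `D_v`
  have hfixQ : ∀ δ ∈ GreenbergSelmer.decomp v, δ • Q = Q := by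
    intro δ hδ
    obtain ⟨σ, rfl⟩ := (GreenbergSelmer.mem_decomp_iff v δ).mp hδ
    exact hQ σ
  -- the `E[𝔮_r^∞]`-component
  have hx : 4 • ((e Q : ↥((W.baseChange K).endEigenPrimaryTorsion 2 π r)) : (W.baseChange K).geomPrimaryTorsion 2) = 0 := by
    refine h4₁ _ (e Q).2 ?_
    rw [← WeierstrassCurve.endEigenPrimaryTorsion.coe_smul, ← he δ₁ Q, hfixQ δ₁ hδ₁]
  -- the `E[𝔮_{1−r}^∞]`-component
  have hy : 4 • (Q - (e Q : (W.baseChange K).geomPrimaryTorsion 2)) = 0 := by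
    refine h4₂ _ (hesub Q) ?_
    rw [smul_sub, hfixQ δ₂ hδ₂, ← WeierstrassCurve.endEigenPrimaryTorsion.coe_smul, ← he δ₂ Q, hfixQ δ₂ hδ₂]
  have hsum : Q = (e Q : (W.baseChange K).geomPrimaryTorsion 2) + (Q - (e Q : (W.baseChange K).geomPrimaryTorsion 2)) := by abel
  rw [show (2 : ℕ) ^ 2 = 4 by norm_num, hsum, smul_add, hx, hy, add_zero]

/-- **hfinR′ on every S3c frame from the frame's own bottom finiteness `𝔖_{v̄}(K, W*)`**: conjugation transport to `𝔖_v(K, W*′)` finite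
(-w2 g10 `ConjTransport.finite_restrictedSelmerBase_conj_of_finite`), then §1. [cite: Agboola2007, §6 Prop. 6.10–6.11] [cite: JetchevSkinnerWan2017, Prop. 3.3.2] -/
theorem finite_map_selmerGroup_acStructure_of_frame_of_finite {d : ℤ} (hd0 : d ≠ 0) (W : WeierstrassCurve ℚ) [W.IsElliptic]
    (C : VariableChange ℚ) (hC : C • W = cm7.quadraticTwist (d : ℚ)) (hK : IsImaginaryQuadratic K)
    {v vbar : HeightOneSpectrum (𝓞 K)} (hv : ((2 : ℕ) : 𝓞 K) ∈ v.asIdeal) (hvbar : ((2 : ℕ) : 𝓞 K) ∈ vbar.asIdeal) (hne : vbar ≠ v)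
    (π : (W.baseChange K).endRing) (hrel : (π : AddMonoid.End (W.baseChange K).geomPoints) * π = π - 2)
    {r : ℤ_[2]} (hr : r * r = r - 2)
    (hfinB : Finite (restrictedSelmerBase ↥((W.baseChange K).endEigenPrimaryTorsion 2 π r) 2 vbar))
    (e' : (W.baseChange K).geomPrimaryTorsion 2 →+ ↥((W.baseChange K).endEigenPrimaryTorsion 2 π (1 - r)))
    (j' : (primaryGaloisModule (W.baseChange K) 2).toContRepresentation →ⁱL (primaryGaloisModule (W.baseChange K) 2).toContRepresentation)
    (hj' : ∀ x, j' x = (e' x : (W.baseChange K).geomPrimaryTorsion 2))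
    {R : Set (HeightOneSpectrum (𝓞 K))} (hR : R.Finite) :
    Finite (((acStructure (primaryGaloisModule (W.baseChange K) 2) 2 v R).selmerGroup).map (galoisCohomology.map j' 1)) := by
  haveI : Fact (Nat.Prime 2) := ⟨Nat.prime_two⟩
  haveI : (W.baseChange K).IsElliptic := by rw [baseChange]; infer_instance
  have hj : W.j = -3375 := j_eq_of_smul_eq_cm7Twist hd0 W C hC
  obtain ⟨θ, hθ⟩ := exists_sq_eq_neg_seven_of_cmEndo_mem_endRing W K hj π hrel
  have hr' : (1 - r) * (1 - r) = (1 - r) - 2 := by linear_combination hr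
  obtain ⟨e₀, he₀₁, -, -, he₀⟩ := exists_eigenProjector_two W hj K hθ π hrel hr'
  -- the arbitrary `e′` is equivariant because `j′ = ι′ e′` is intertwining
  have he' : ∀ (σ : absoluteGaloisGroup K) (x : (W.baseChange K).geomPrimaryTorsion 2), e' (σ • x) = σ • e' x := by
    intro σ x
    have hi := j'.isIntertwining σ x
    rw [ContinuousRep.toContRepresentation_apply_apply, ContinuousRep.toContRepresentation_apply_apply, hj', hj'] at hi
    apply Subtype.ext
    simpa only [primaryGaloisModule, ofSMul_apply_apply, WeierstrassCurve.endEigenPrimaryTorsion.coe_smul] using hi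
  exact finite_map_selmerGroup_acStructure_of_apply_eq_proj (W.baseChange K) 2 π (1 - r) v e₀ he₀₁ he₀ e' he' j' hj' hR
    (ConjTransport.finite_restrictedSelmerBase_conj_of_finite W K hK v vbar hv hvbar hne π hrel r hfinB)

/-! ## §3. The Poitou–Tate residuals of cut 9 from the cited facts alone -/

/-- **RESIDUAL (R-SURJ″) OF CUT 9 DISCHARGED modulo the cited fact `poitouTate_selmerStructure_duality`**: `hSurj` of
`restrictedControl_two_of_top_surj_bv` (p671311; byte-identical to p668543's) VERBATIM with `e_s ≡ −1`. Per frame: `𝔖^Γ` finite (binder) ⟹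
`𝔖_{v̄}(K, W*)` finite (file 4c) ⟹ hfinR′ (§2) and hfix (§2) ⟹ (LS) (`locSurj_of_frame_of_conjFiniteness`, p673366) ⟹ δ = 1 ⟹ `relIndex · 2 = ∏`.
[cite: Agboola2007, §3 Prop. 3.2, §6] [cite: Howard2004HeegnerKolyvagin, Thm. 2.1.11] [cite: JetchevSkinnerWan2017, Prop. 3.3.2] -/
theorem rSurj''_of_poitouTate
    (hPTs : ∀ (K : Type) [Field K] [NumberField K], poitouTate_selmerStructure_duality K) :
    ∃ es : ℤ → ℤ → ℤ, ∀ (d : ℤ), d ≠ 0 → Squarefree d → d % 4 ≠ 1 →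
      ∀ (W : WeierstrassCurve ℚ) [W.IsElliptic] [W.IsGloballyMinimal] (C : VariableChange ℚ),
        C • W = cm7.quadraticTwist (d : ℚ) → W.analyticRank = 1 →
      ∀ (K : Type) [Field K] [NumberField K], IsImaginaryQuadratic K →
      ∀ (v vbar : HeightOneSpectrum (𝓞 K)),
        ((2 : ℕ) : 𝓞 K) ∈ v.asIdeal → ((2 : ℕ) : 𝓞 K) ∈ vbar.asIdeal → vbar ≠ v →
      ∀ (π : (W.baseChange K).endRing), (π : AddMonoid.End (W.baseChange K).geomPoints) * π = π - 2 →
      ∀ (r : ℤ_[2]), r * r = r - 2 →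
        (∀ τ ∈ GreenbergSelmer.inertia v, ∀ x : ↥((W.baseChange K).endEigenPrimaryTorsion 2 π r), τ • x = x ∨ τ • x = -x) →
      ∀ (κ' : ZpExtension K 2), κ'.IsUnramifiedOutside vbar → ∀ (γ' : absoluteGaloisGroup K), κ'.IsTopGenerator γ' →
      Finite (endInvariants (conjRestricted κ' ↥((W.baseChange K).endEigenPrimaryTorsion 2 π r) vbar γ' - 1)) →
      ∀ (T : Finset (HeightOneSpectrum (𝓞 K))),
        (∀ w : HeightOneSpectrum (𝓞 K), w ∈ T ↔ ((2 : ℕ) : 𝓞 K) ∉ w.asIdeal ∧ ((7 * d : ℤ) : 𝓞 K) ∈ w.asIdeal) →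
        (padicValNat 2 ((((restrictedSelmerBase ↥((W.baseChange K).endEigenPrimaryTorsion 2 π r) 2 vbar).map
            (resOfLe ↥((W.baseChange K).endEigenPrimaryTorsion 2 π r) (le_top : κ'.kerSubgroup ≤ ⊤))).addSubgroupOf
            (restrictedSelmerZp κ' ↥((W.baseChange K).endEigenPrimaryTorsion 2 π r) vbar)).relIndex
          (endInvariants (conjRestricted κ' ↥((W.baseChange K).endEigenPrimaryTorsion 2 π r) vbar γ' - 1))) : ℤ) =
        (∑ w ∈ T, padicValNat 2 (Nat.card (resOfLe ↥((W.baseChange K).endEigenPrimaryTorsion 2 π r) (inf_le_inf_right (decomp w) (le_top : κ'.kerSubgroup ≤ ⊤))).ker) : ℕ) +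
          padicValNat 2 (Nat.card (resOfLe ↥((W.baseChange K).endEigenPrimaryTorsion 2 π r) (inf_le_inf_right (decomp vbar) (le_top : κ'.kerSubgroup ≤ ⊤))).ker) +
          es (d % 2) ((d / (2 - d % 2)) % 8) := by
  refine rSurj''_of_locSurj_of_finite ?_
  intro d hd0 _ _ W _ C hC K _ _ hK v vbar hv hvbar hne π hrel r hr hfinB
  exact locSurj_of_frame_of_conjFiniteness hd0 W C hC hK hv hvbar hne π hrel hr (hPTs K)
    (fun e' j' hj' R hR _ ↦ finite_map_selmerGroup_acStructure_of_frame_of_finite hd0 W C hC hK hv hvbar hne π hrel hr hfinB e' j' hj' hR)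
    (two_pow_two_nsmul_eq_zero_of_restrictField_fixed_of_frame hd0 W C hC hK hv hvbar hne π hrel hr)

/-- **(R-TOP) ON EVERY S3c FRAME FROM THE THREE CITED FACTS ALONE** — -w4 g9's `natCard_endCoinvariants_eq_one_of_frame_of_conjFiniteness` (p673077)
with hfinB′ (conjugation transport of the datum's bottom finiteness, -w2 g10), hfinR′ and hfix (§2) DISCHARGED: `#𝔖_Γ = 1`.
[cite: Agboola2007, §5 Prop. 5.1] [cite: JetchevSkinnerWan2017, Lemma 3.3.3 and Prop. 3.3.2] [cite: GreenbergLNM1716, §4 Props. 4.13–4.15] -/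
theorem natCard_endCoinvariants_eq_one_of_frame_of_poitouTate {d : ℤ} (hd0 : d ≠ 0) (W : WeierstrassCurve ℚ) [W.IsElliptic]
    [W.IsGloballyMinimal] (C : VariableChange ℚ) (hC : C • W = cm7.quadraticTwist (d : ℚ)) (hK : IsImaginaryQuadratic K)
    {v vbar : HeightOneSpectrum (𝓞 K)} (hv : ((2 : ℕ) : 𝓞 K) ∈ v.asIdeal) (hvbar : ((2 : ℕ) : 𝓞 K) ∈ vbar.asIdeal) (hne : vbar ≠ v)
    (π : (W.baseChange K).endRing) (hrel : (π : AddMonoid.End (W.baseChange K).geomPoints) * π = π - 2) {r : ℤ_[2]} (hr : r * r = r - 2)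
    (κ' : ZpExtension K 2) (hκ' : κ'.IsUnramifiedOutside vbar) {γ' : absoluteGaloisGroup K} (hγ' : κ'.IsTopGenerator γ')
    (D : RestrictedDualData κ' ↥((W.baseChange K).endEigenPrimaryTorsion 2 π r) vbar γ') {n : ℕ}
    (hDf : Module.Finite (IwasawaAlgebra 2) D.X) (hDn : D.HasCharValuationAt n)
    (hPT : poitouTate_sha_tateDual K) (hPTs : poitouTate_selmerStructure_duality K) (hcd : fieldCdLE_two_of_numberField) :
    Nat.card (EndCoinvariants (conjRestricted κ' ↥((W.baseChange K).endEigenPrimaryTorsion 2 π r) vbar γ' - 1)) = 1 := by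
  haveI := hDf
  have hfinB : Finite (restrictedSelmerBase ↥((W.baseChange K).endEigenPrimaryTorsion 2 π r) 2 vbar) :=
    (hasCharValuationAt_control_identity_endEigenPrimaryTorsion (W.baseChange K) 2 π r κ' hγ' vbar D hDn).2.2.1
  exact natCard_endCoinvariants_eq_one_of_frame_of_conjFiniteness hd0 W C hC hK v vbar hv hvbar hne π hrel hr κ' hκ' hγ' D hDf hDn
    hPT hPTs hcd (ConjTransport.finite_restrictedSelmerBase_conj_of_finite W K hK v vbar hv hvbar hne π hrel r hfinB)
    (fun e' j' hj' R hR _ ↦ finite_map_selmerGroup_acStructure_of_frame_of_finite hd0 W C hC hK hv hvbar hne π hrel hr hfinB e' j' hj' hR)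
    (two_pow_two_nsmul_eq_zero_of_restrictField_fixed_of_frame hd0 W C hC hK hv hvbar hne π hrel hr)

/-- **(R-TOP′) OF CUT 9 in class-function form (`eΓ ≡ 0`; `hTop` text of `restrictedControl_two_of_top_surj_bv` p671311 with ONE extra instance
binder `[W.IsGloballyMinimal]` after `[W.IsElliptic]`) FROM THE THREE CITED FACTS ALONE.** [cite: Agboola2007, §5 Prop. 5.1]
[cite: JetchevSkinnerWan2017, Lemma 3.3.3 and Prop. 3.3.2] [cite: GreenbergLNM1716, §4 Props. 4.13–4.15] -/
theorem rTop'_of_poitouTate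
    (hPT : ∀ (K : Type) [Field K] [NumberField K], poitouTate_sha_tateDual K)
    (hPTs : ∀ (K : Type) [Field K] [NumberField K], poitouTate_selmerStructure_duality K) (hcd : fieldCdLE_two_of_numberField) :
    ∃ eΓ : ℤ → ℤ → ℤ, ∀ (d : ℤ), d ≠ 0 → Squarefree d → d % 4 ≠ 1 →
      ∀ (W : WeierstrassCurve ℚ) [W.IsElliptic] [W.IsGloballyMinimal] (C : VariableChange ℚ), C • W = cm7.quadraticTwist (d : ℚ) →
      ∀ (K : Type) [Field K] [NumberField K], IsImaginaryQuadratic K →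
      ∀ (v vbar : HeightOneSpectrum (𝓞 K)),
        ((2 : ℕ) : 𝓞 K) ∈ v.asIdeal → ((2 : ℕ) : 𝓞 K) ∈ vbar.asIdeal → vbar ≠ v →
      ∀ (π : (W.baseChange K).endRing), (π : AddMonoid.End (W.baseChange K).geomPoints) * π = π - 2 →
      ∀ (r : ℤ_[2]), r * r = r - 2 →
        (∀ τ ∈ GreenbergSelmer.inertia v, ∀ x : ↥((W.baseChange K).endEigenPrimaryTorsion 2 π r), τ • x = x ∨ τ • x = -x) →
      ∀ (κ' : ZpExtension K 2), κ'.IsUnramifiedOutside vbar → ∀ (γ' : absoluteGaloisGroup K), κ'.IsTopGenerator γ' →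
      ∀ (D : Agboola2007.RestrictedDualData κ' ↥((W.baseChange K).endEigenPrimaryTorsion 2 π r) vbar γ') (n : ℕ),
        Module.Finite (IwasawaAlgebra 2) D.X → D.HasCharValuationAt n →
        (padicValNat 2 (Nat.card (EndCoinvariants (conjRestricted κ' ↥((W.baseChange K).endEigenPrimaryTorsion 2 π r) vbar γ' - 1))) : ℤ) =
          eΓ (d % 2) ((d / (2 - d % 2)) % 8) := by
  refine ⟨fun _ _ ↦ 0, ?_⟩
  intro d hd0 _ _ W _ _ C hC K _ _ hK v vbar hv hvbar hne π hrel r hr _ κ' hκ' γ' hγ' D n hDf hDn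
  rw [natCard_endCoinvariants_eq_one_of_frame_of_poitouTate hd0 W C hC hK hv hvbar hne π hrel hr κ' hκ' hγ' D hDf hDn
    (hPT K) (hPTs K) hcd, padicValNat_one_right]
  simp

end Frame

end Summit.BirchSwinnertonDyer.BirchSwinnertonDyer.Theorems.PrintCf2.RestrictedSelmerPair

end
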